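import Literature.Probability.Percolation.DecisionTreeWeighted
import Mathlib.Tactic.Linarith
import HarnessLib

/-!
# Dominated martingale increments along a decision tree: a comparison form of Gladkov's Theorem 3.2

builds on p205010 (kernel theorem, internal audit signed; external expert review pending)

PAPER-2 track "percolation constants", part (ii), seat `prim-consts-1`, gen 16 (lane index
`run/shared/lean/prim/consts/CONSTANTS.md`, row A19; memo `FROM-prim-consts-1-g15-CLUSTER-SQUARE.md` §7).  Support file for the
crux `NoHeavyLowerTail` (stmt-CriticalPhenomena-4575; `--supports`).  Theorems only, no definitions, no sorries.

Setting: the finitary calculus of `DecisionTreeWeighted.lean` (configurations `C ⊆ D : Finset ι`, inhomogeneous Bernoulli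
weights `wtW D p`, one- and two-configuration probabilities `PrW`, `Pr2W`, decision trees `DTree ι` reading the first
configuration and building the revealed set `S(C₁) = revealed T C₁`, the splice `C₁ →_S C₂ = splice S C₁ C₂`).  For an event
`B` write `Q_T(B) := Pr2W (treeHK ∅ T B B) = P(C₁ ∈ B, C₁ →_{S(C₁)} C₂ ∈ B) = Σ_{leaves N} P(N) · P(B | N)²`, so that
`Q_T(B) − P(B)²` is the variance of the conditional probability `P(B | the leaf of T reached)` — the sum of the squared
increments of the Doob martingale of `1_B` along the tree.

THE RESULT (`Consts.TreeCompare.Pr2W_treeHK_sub_sq_le`).  Let `U` be a down-set and `A` an up-set of configurations with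
`U ∩ A = ∅`, and suppose the TRANSFER HYPOTHESIS holds at every query of the tree: whenever `T` queries the coordinate `e` on
(the path of) a configuration `C` with `e ∉ C`, `C ∈ U` and `C ∪ {e} ∉ U` (the coordinate `e`, opened, takes `C` out of `U`), then
`C ∉ A` and `C ∪ {e} ∈ A` (it takes `C` into `A`).  Then
  `Q_T(U) − P(U)² ≤ Q_T(A) − P(A)²`,
i.e. the martingale of `1_U` has pointwise smaller increments than that of `1_A`, hence smaller variance at the leaves.
Proof: root-first induction on the tree; at a node the one-step inequality
`P(Z ∩ hk_{S∪e}(U)) + P(Z ∩ hk_S(A)) ≤ P(Z ∩ hk_{S∪e}(A)) + P(Z ∩ hk_S(U))` (`Consts.TreeCompare.step_le`) is proved by the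
one-coordinate swap `(C₁, C₂) ↦ (C₁ →_{D∖e} C₂, C₂ →_{D∖e} C₁)` of Gladkov's proof of Theorem 3.2, which maps the excess pairs of
`U` and the deficit pairs of `A` injectively and weight-preservingly into the deficit pairs of `U` and the excess pairs of `A`
(`Consts.TreeCompare.swapAt_mem`).  No equality (variance identity) is needed.

Use (file `…ConstsClusterSquareVariance.lean`): with `T` the exploration of the open cluster of a vertex `a`, `U = {b ↮ c}`,
`A = {a ↔ b, a ↔ c}` the transfer hypothesis is the graph-theoretic fact "a boundary edge of the cluster of `a` is pivotal for
`{b ↔ c}` only by creating `{a ↔ b ↔ c}`", giving `Var(P(b ↮ c | C_a)) ≤ Var(1_{a↔b↔c})` and the partial cluster-square inequality.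

References: N. Gladkov, *Percolation inequalities and decision trees*, arXiv:2408.08457v2 (2024), Lemma 3.1, Thm. 3.2 and its
proof (inequality (5), the one-coordinate swap); J. L. Doob's martingale (variance decomposition along a filtration), folklore.
-/

noncomputable section

namespace Summit.CriticalPhenomena.PercolationContinuityZ3.Theorems

open Finset Literature.Probability.Percolation Literature.Probability.Percolation.DecisionTree

namespace Consts

namespace TreeCompare

variable {ι : Type*} [DecidableEq ι]

/-! ### Splices along `S` and `S ∪ {e}` -/

/-- Off the coordinate `e ∉ S`, the splices along `S` and along `S ∪ {e}` agree. [folklore] -/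
theorem mem_splice_insert_iff_of_ne {S X₁ X₂ : Finset ι} {e i : ι} (hie : i ≠ e) :
    i ∈ splice (insert e S) X₁ X₂ ↔ i ∈ splice S X₁ X₂ := by
  rw [mem_splice_insert, mem_splice]
  constructor
  · rintro (⟨h, -⟩ | ⟨-, h⟩)
    · exact absurd h hie
    · exact h
  · exact fun h => Or.inr ⟨hie, h⟩

/-- At the coordinate `e`: `e ∈ C₁ →_{S ∪ {e}} C₂ ↔ e ∈ C₁`. [folklore] -/
theorem mem_splice_insert_self {S X₁ X₂ : Finset ι} {e : ι} :
    e ∈ splice (insert e S) X₁ X₂ ↔ e ∈ X₁ := by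
  rw [mem_splice_insert]
  constructor
  · rintro (⟨-, h⟩ | ⟨h, -⟩)
    · exact h
    · exact absurd rfl h
  · exact fun h => Or.inl ⟨rfl, h⟩

/-- If NOT (`e ∉ C₁` and `e ∈ C₂`), the `S`-splice lies below the `S ∪ {e}`-splice (`e ∉ S`). [folklore] -/
theorem splice_subset_splice_insert {S X₁ X₂ : Finset ι} {e : ι} (he : e ∉ S) (h : e ∈ X₂ → e ∈ X₁) :
    splice S X₁ X₂ ⊆ splice (insert e S) X₁ X₂ := by
  intro i hi
  by_cases hie : i = e
  · subst hie
    exact mem_splice_insert_self.2 (h ((mem_splice_of_not_mem he).1 hi))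
  · exact (mem_splice_insert_iff_of_ne hie).2 hi

/-! ### The one-coordinate swap -/

section Swap

variable {D S : Finset ι} {e : ι} {x : Finset ι × Finset ι}

/-- First component of the swap at `e` when `e ∉ C₁`, `e ∈ C₂`: it is `C₁ ∪ {e}`. [cite: Gladkov2024, proof of Thm. 3.2 (the swap of one coordinate)] -/
theorem mem_swapAt_fst_iff (hx1 : x.1 ⊆ D) (hx2 : x.2 ⊆ D) (he1 : e ∉ x.1) (he2 : e ∈ x.2) (i : ι) :
    i ∈ (swapAt D e x).1 ↔ i ∈ insert e x.1 := by
  rw [mem_swapAt_fst hx1 hx2, Finset.mem_insert]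
  constructor
  · rintro (⟨-, h⟩ | ⟨h, -⟩)
    · exact Or.inr h
    · exact Or.inl h
  · rintro (h | h)
    · exact Or.inr ⟨h, h ▸ he2⟩
    · exact Or.inl ⟨fun h' => he1 (h' ▸ h), h⟩

/-- Second component of the swap at `e` when `e ∉ C₁`: it is `C₂ ∖ {e}`. [cite: Gladkov2024, proof of Thm. 3.2] -/
theorem mem_swapAt_snd_iff (hx1 : x.1 ⊆ D) (hx2 : x.2 ⊆ D) (he1 : e ∉ x.1) (i : ι) :
    i ∈ (swapAt D e x).2 ↔ i ≠ e ∧ i ∈ x.2 := by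
  rw [mem_swapAt_snd hx1 hx2]
  constructor
  · rintro (h | ⟨h, h'⟩)
    · exact h
    · exact absurd (h ▸ h') he1
  · exact fun h => Or.inl h

/-- After the swap (`e ∉ S`, `e ∉ C₁`, `e ∈ C₂`) the `S`-splice is the old `S ∪ {e}`-splice. [cite: Gladkov2024, proof of Thm. 3.2] -/
theorem splice_swapAt_eq (he : e ∉ S) (hx1 : x.1 ⊆ D) (hx2 : x.2 ⊆ D) (he1 : e ∉ x.1) (he2 : e ∈ x.2) :
    splice S (swapAt D e x).1 (swapAt D e x).2 = splice (insert e S) x.1 x.2 := by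
  ext i
  by_cases hie : i = e
  · subst hie
    rw [mem_splice_of_not_mem he, mem_swapAt_snd_iff hx1 hx2 he1, mem_splice_insert_self]
    exact ⟨fun h => absurd rfl h.1, fun h => absurd h he1⟩
  · rw [mem_splice_insert_iff_of_ne hie, mem_splice, mem_splice, mem_swapAt_fst_iff hx1 hx2 he1 he2,
      mem_swapAt_snd_iff hx1 hx2 he1, Finset.mem_insert]
    simp [hie]

/-- After the swap (`e ∉ S`, `e ∉ C₁`, `e ∈ C₂`) the `S ∪ {e}`-splice is the old `S`-splice. [cite: Gladkov2024, proof of Thm. 3.2] -/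
theorem splice_insert_swapAt_eq (he : e ∉ S) (hx1 : x.1 ⊆ D) (hx2 : x.2 ⊆ D) (he1 : e ∉ x.1) (he2 : e ∈ x.2) :
    splice (insert e S) (swapAt D e x).1 (swapAt D e x).2 = splice S x.1 x.2 := by
  ext i
  by_cases hie : i = e
  · subst hie
    rw [mem_splice_insert_self, mem_swapAt_fst_iff hx1 hx2 he1 he2, mem_splice_of_not_mem he,
      Finset.mem_insert]
    exact ⟨fun _ => he2, fun _ => Or.inl rfl⟩
  · rw [mem_splice_insert_iff_of_ne hie, mem_splice, mem_splice, mem_swapAt_fst_iff hx1 hx2 he1 he2,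
      mem_swapAt_snd_iff hx1 hx2 he1, Finset.mem_insert]
    simp [hie]

/-- With `e ∉ S`, `e ∉ C₁`, `e ∈ C₂`: opening `e` in the `S ∪ {e}`-splice gives the `S`-splice. [folklore] -/
theorem insert_splice_insert_eq (he : e ∉ S) (he1 : e ∉ x.1) (he2 : e ∈ x.2) :
    insert e (splice (insert e S) x.1 x.2) = splice S x.1 x.2 := by
  ext i
  rw [Finset.mem_insert]
  by_cases hie : i = e
  · subst hie
    simp only [true_or, true_iff]
    exact (mem_splice_of_not_mem he).2 he2
  · rw [mem_splice_insert_iff_of_ne hie]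
    simp [hie]

end Swap

/-- **The combinatorial heart** (one-coordinate swap, comparison form).  Let `e ∉ S`, `U` a down-set, `A` an up-set, and
assume the transfer hypothesis at `e` for `C₁` and for `C₁ →_{S∪{e}} C₂`.  If `(C₁, C₂)` is an excess pair of `U`
(`C₁ ∈ U`, `C₁ →_{S∪{e}} C₂ ∈ U`, `C₁ →_S C₂ ∉ U`) or a deficit pair of `A` (`C₁ ∈ A`, `C₁ →_S C₂ ∈ A`, `C₁ →_{S∪{e}} C₂ ∉ A`),
then the pair with the coordinate `e` exchanged is a deficit pair of `U` or an excess pair of `A`.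
[cite: Gladkov2024, proof of Thm. 3.2 (inequality (5): the swap of the coordinate e)] -/
theorem swapAt_mem {D S : Finset ι} {e : ι} (he : e ∉ S) {U A : Set (Finset ι)} (hU : IsLowerSet U)
    (hA : IsUpperSet A) {x : Finset ι × Finset ι} (hx1 : x.1 ⊆ D) (hx2 : x.2 ⊆ D)
    (hG1 : e ∉ x.1 → x.1 ∈ U → insert e x.1 ∉ U → (x.1 ∉ A ∧ insert e x.1 ∈ A))
    (hG2 : e ∉ splice (insert e S) x.1 x.2 → splice (insert e S) x.1 x.2 ∈ U →
      insert e (splice (insert e S) x.1 x.2) ∉ U →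
        (splice (insert e S) x.1 x.2 ∉ A ∧ insert e (splice (insert e S) x.1 x.2) ∈ A))
    (hx : x ∈ (hkWith (insert e S) U U \ hkWith S U U) ∪ (hkWith S A A \ hkWith (insert e S) A A)) :
    swapAt D e x ∈ (hkWith S U U \ hkWith (insert e S) U U) ∪ (hkWith (insert e S) A A \ hkWith S A A) := by
  -- in both cases `e ∉ C₁` and `e ∈ C₂`
  have hee : e ∉ x.1 ∧ e ∈ x.2 := by
    by_contra hne
    have hsub : splice S x.1 x.2 ⊆ splice (insert e S) x.1 x.2 :=
      splice_subset_splice_insert he fun h2 => by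
        by_contra h1
        exact hne ⟨h1, h2⟩
    rcases hx with ⟨⟨hxU, hpU⟩, h0⟩ | ⟨⟨hxA, h0A⟩, hp⟩
    · exact h0 ⟨hxU, hU hsub hpU⟩
    · exact hp ⟨hxA, hA hsub h0A⟩
  obtain ⟨he1, he2⟩ := hee
  have hfst : (swapAt D e x).1 = insert e x.1 := by
    ext i; exact mem_swapAt_fst_iff hx1 hx2 he1 he2 i
  have hsp0 := splice_swapAt_eq he hx1 hx2 he1 he2
  have hspp := splice_insert_swapAt_eq he hx1 hx2 he1 he2
  have hins := insert_splice_insert_eq (S := S) he he1 he2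
  have hep : e ∉ splice (insert e S) x.1 x.2 := fun h => he1 (mem_splice_insert_self.1 h)
  rcases hx with ⟨⟨hxU, hpU⟩, h0⟩ | ⟨⟨hxA, h0A⟩, hp⟩
  · -- an excess pair of `U`
    have h0U : splice S x.1 x.2 ∉ U := fun h => h0 ⟨hxU, h⟩
    by_cases hins1 : insert e x.1 ∈ U
    · left
      refine ⟨⟨?_, ?_⟩, fun h => h0U ?_⟩
      · rw [hfst]; exact hins1
      · rw [hsp0]; exact hpU
      · rw [← hspp]; exact h.2
    · right
      have h1 := hG1 he1 hxU hins1
      have h2 := hG2 hep hpU (by rw [hins]; exact h0U)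
      refine ⟨⟨?_, ?_⟩, fun h => h2.1 ?_⟩
      · rw [hfst]; exact h1.2
      · rw [hspp, ← hins]; exact h2.2
      · rw [← hsp0]; exact h.2
  · -- a deficit pair of `A`
    right
    have hyA : insert e x.1 ∈ A := hA (Finset.subset_insert e x.1) hxA
    refine ⟨⟨?_, ?_⟩, fun h => hp ⟨hxA, ?_⟩⟩
    · rw [hfst]; exact hyA
    · rw [hspp]; exact h0A
    · rw [← hsp0]; exact h.2

/-! ### The one-step inequality -/

/-- **One query, summed**: for `e ∉ S`, a down-set `U` disjoint from an up-set `A`, and an `S`-local set `R` of first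
configurations on which the transfer hypothesis at `e` holds,
`P(Z ∩ hk_{S∪e}(U,U)) + P(Z ∩ hk_S(A,A)) ≤ P(Z ∩ hk_{S∪e}(A,A)) + P(Z ∩ hk_S(U,U))`, `Z = {C₁ ∈ R}` — revealing one more
coordinate raises `P(C₁ ∈ B, C₁ →_S C₂ ∈ B)` by less for `B = U` than for `B = A`.
[cite: Gladkov2024, proof of Thm. 3.2 (inequality (5) summed; Lemma 3.1 for the swap)] -/
theorem step_le (D : Finset ι) {p : ι → ℝ} (hp0 : ∀ i, 0 ≤ p i) (hp1 : ∀ i, p i ≤ 1) {S : Finset ι} {e : ι}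
    (he : e ∉ S) {U A : Set (Finset ι)} (hU : IsLowerSet U) (hA : IsUpperSet A) (hUA : ∀ C ∈ U, C ∉ A)
    {R : Set (Finset ι)} (hR : ∀ C C' : Finset ι, (∀ i ∈ S, (i ∈ C ↔ i ∈ C')) → C ∈ R → C' ∈ R)
    (hG : ∀ C ∈ R, e ∉ C → C ∈ U → insert e C ∉ U → (C ∉ A ∧ insert e C ∈ A)) :
    Pr2W D p ({x | x.1 ∈ R} ∩ hkWith (insert e S) U U) + Pr2W D p ({x | x.1 ∈ R} ∩ hkWith S A A) ≤
      Pr2W D p ({x | x.1 ∈ R} ∩ hkWith (insert e S) A A) + Pr2W D p ({x | x.1 ∈ R} ∩ hkWith S U U) := by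
  set Z : Set (Finset ι × Finset ι) := {x | x.1 ∈ R} with hZ
  set HUp := hkWith (insert e S) U U
  set HU0 := hkWith S U U
  set HAp := hkWith (insert e S) A A
  set HA0 := hkWith S A A
  have e1 := Pr2W_eq_inter_add_diff D p (Z ∩ HUp) HU0
  have e2 := Pr2W_eq_inter_add_diff D p (Z ∩ HU0) HUp
  have e3 := Pr2W_eq_inter_add_diff D p (Z ∩ HA0) HAp
  have e4 := Pr2W_eq_inter_add_diff D p (Z ∩ HAp) HA0
  have c1 : Pr2W D p (Z ∩ HUp ∩ HU0) = Pr2W D p (Z ∩ HU0 ∩ HUp) := by rw [Set.inter_right_comm]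
  have c2 : Pr2W D p (Z ∩ HA0 ∩ HAp) = Pr2W D p (Z ∩ HAp ∩ HA0) := by rw [Set.inter_right_comm]
  -- the excess of `U` and the deficit of `A` are disjoint (`U ∩ A = ∅`)
  have hdisj : Disjoint ((Z ∩ HUp) \ HU0) ((Z ∩ HA0) \ HAp) :=
    Set.disjoint_left.2 fun x hx hx' => hUA x.1 hx.1.2.1 hx'.1.2.1
  have hswap : Pr2W D p (((Z ∩ HUp) \ HU0) ∪ ((Z ∩ HA0) \ HAp)) ≤
      Pr2W D p (((Z ∩ HU0) \ HUp) ∪ ((Z ∩ HAp) \ HA0)) := by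
    calc Pr2W D p (((Z ∩ HUp) \ HU0) ∪ ((Z ∩ HA0) \ HAp))
        ≤ Pr2W D p (swapPair (fun _ : Finset ι => D.erase e) ⁻¹' (((Z ∩ HU0) \ HUp) ∪ ((Z ∩ HAp) \ HA0))) := by
          refine Pr2W_mono D hp0 hp1 fun x hx1 hx2 hx => ?_
          have hx1R : x.1 ∈ R := by
            rcases hx with h | h
            · exact h.1.1
            · exact h.1.1
          -- the swapped pair stays in `Z`
          have hZ' : swapAt D e x ∈ Z := by
            refine hR x.1 _ (fun i hi => ?_) hx1R
            rw [mem_swapAt_fst hx1 hx2]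
            have hie : i ≠ e := fun h => he (h ▸ hi)
            simp [hie]
          have hspR : splice (insert e S) x.1 x.2 ∈ R :=
            hR x.1 _ (fun i hi => (mem_splice_of_mem (Finset.mem_insert_of_mem hi)).symm) hx1R
          have hx' : x ∈ (HUp \ HU0) ∪ (HA0 \ HAp) := by
            rcases hx with h | h
            · exact Or.inl ⟨h.1.2, h.2⟩
            · exact Or.inr ⟨h.1.2, h.2⟩
          have hsw := swapAt_mem (D := D) he hU hA hx1 hx2 (hG x.1 hx1R) (hG _ hspR) hx'
          show swapAt D e x ∈ ((Z ∩ HU0) \ HUp) ∪ ((Z ∩ HAp) \ HA0)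
          rcases hsw with h | h
          · exact Or.inl ⟨⟨hZ', h.1⟩, h.2⟩
          · exact Or.inr ⟨⟨hZ', h.1⟩, h.2⟩
      _ = Pr2W D p (((Z ∩ HU0) \ HUp) ∪ ((Z ∩ HAp) \ HA0)) :=
          Pr2W_preimage_swapPair D p (selfDetermined_const (D.erase e)) _
  have hL : Pr2W D p (((Z ∩ HUp) \ HU0) ∪ ((Z ∩ HA0) \ HAp)) =
      Pr2W D p ((Z ∩ HUp) \ HU0) + Pr2W D p ((Z ∩ HA0) \ HAp) := Pr2W_union D p hdisj
  have hRle := Pr2W_union_le D hp0 hp1 ((Z ∩ HU0) \ HUp) ((Z ∩ HAp) \ HA0)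
  linarith

/-! ### Along a tree -/

/-- Splitting a `Pr2W` by the query `e ∈ C₁`. [folklore] -/
theorem Pr2W_split (D : Finset ι) (p : ι → ℝ) (Z Y : Set (Finset ι × Finset ι)) (e : ι) :
    Pr2W D p (Z ∩ Y) = Pr2W D p ((Z ∩ {x | e ∈ x.1}) ∩ Y) + Pr2W D p ((Z ∩ {x | e ∉ x.1}) ∩ Y) := by
  rw [← Pr2W_union D p]
  · congr 1
    ext x
    simp only [Set.mem_inter_iff, Set.mem_setOf_eq, Set.mem_union]
    tauto
  · exact Set.disjoint_left.2 fun x hx hx' => hx'.1.2 hx.1.2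

/-- Unfolding `treeHK` at a node inside a `Pr2W`. [folklore] -/
theorem Pr2W_treeHK_node (D : Finset ι) (p : ι → ℝ) (Z : Set (Finset ι × Finset ι)) (S₀ : Finset ι) (e : ι)
    (yes no : DTree ι) (B : Set (Finset ι)) :
    Pr2W D p (Z ∩ treeHK S₀ (.node e yes no) B B) =
      Pr2W D p ((Z ∩ {x | e ∈ x.1}) ∩ treeHK (insert e S₀) yes B B) +
        Pr2W D p ((Z ∩ {x | e ∉ x.1}) ∩ treeHK (insert e S₀) no B B) := by
  rw [treeHK_node, Set.inter_union_distrib_left, Pr2W_union]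
  · congr 1
    · congr 1; ext x; simp only [Set.mem_inter_iff, Set.mem_setOf_eq]; tauto
    · congr 1; ext x; simp only [Set.mem_inter_iff, Set.mem_setOf_eq]; tauto
  · exact Set.disjoint_left.2 fun x hx hx' => hx'.2.2 hx.2.2

/-- **Root-first induction along the tree**: with a pre-shared set `S₀`, an `S₀`-local set `R` of first configurations,
and the transfer hypothesis at every coordinate the tree queries on configurations of `R`,
`P(Z ∩ Q_T(U)) − P(Z ∩ hk_{S₀}(U)) ≤ P(Z ∩ Q_T(A)) − P(Z ∩ hk_{S₀}(A))`, `Z = {C₁ ∈ R}`.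
[cite: Gladkov2024, proof of Thm. 3.2 (induction over the tree)] -/
theorem tree_le (D : Finset ι) {p : ι → ℝ} (hp0 : ∀ i, 0 ≤ p i) (hp1 : ∀ i, p i ≤ 1) {U A : Set (Finset ι)}
    (hU : IsLowerSet U) (hA : IsUpperSet A) (hUA : ∀ C ∈ U, C ∉ A) :
    ∀ (T : DTree ι) (S₀ : Finset ι) (R : Set (Finset ι)),
      (∀ C C' : Finset ι, (∀ i ∈ S₀, (i ∈ C ↔ i ∈ C')) → C ∈ R → C' ∈ R) →
      (∀ C ∈ R, ∀ e ∈ revealed T C, e ∉ C → C ∈ U → insert e C ∉ U → (C ∉ A ∧ insert e C ∈ A)) →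
      Pr2W D p ({x | x.1 ∈ R} ∩ treeHK S₀ T U U) + Pr2W D p ({x | x.1 ∈ R} ∩ hkWith S₀ A A) ≤
        Pr2W D p ({x | x.1 ∈ R} ∩ treeHK S₀ T A A) + Pr2W D p ({x | x.1 ∈ R} ∩ hkWith S₀ U U)
  | .leaf, S₀, R, _, _ => by rw [treeHK_leaf, treeHK_leaf, add_comm]
  | .node e yes no, S₀, R, hR, hG => by
      set Z : Set (Finset ι × Finset ι) := {x | x.1 ∈ R} with hZ
      -- the two sub-contexts
      set Ry : Set (Finset ι) := R ∩ {C | e ∈ C} with hRy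
      set Rn : Set (Finset ι) := R ∩ {C | e ∉ C} with hRn
      have hZy : Z ∩ {x | e ∈ x.1} = {x | x.1 ∈ Ry} := by ext x; simp [hZ, hRy]
      have hZn : Z ∩ {x | e ∉ x.1} = {x | x.1 ∈ Rn} := by ext x; simp [hZ, hRn]
      have hRy_loc : ∀ C C' : Finset ι, (∀ i ∈ insert e S₀, (i ∈ C ↔ i ∈ C')) → C ∈ Ry → C' ∈ Ry :=
        fun C C' h hC => ⟨hR C C' (fun i hi => h i (Finset.mem_insert_of_mem hi)) hC.1,
          (h e (Finset.mem_insert_self e S₀)).1 hC.2⟩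
      have hRn_loc : ∀ C C' : Finset ι, (∀ i ∈ insert e S₀, (i ∈ C ↔ i ∈ C')) → C ∈ Rn → C' ∈ Rn :=
        fun C C' h hC => ⟨hR C C' (fun i hi => h i (Finset.mem_insert_of_mem hi)) hC.1,
          fun h' => hC.2 ((h e (Finset.mem_insert_self e S₀)).2 h')⟩
      have he_rev : ∀ C : Finset ι, e ∈ revealed (.node e yes no) C := fun C => by
        unfold revealed; split_ifs <;> exact Finset.mem_insert_self _ _
      have hGy : ∀ C ∈ Ry, ∀ e' ∈ revealed yes C,
          e' ∉ C → C ∈ U → insert e' C ∉ U → (C ∉ A ∧ insert e' C ∈ A) :=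
        fun C hC e' he' => hG C hC.1 e' (by
          unfold revealed; rw [if_pos (show e ∈ C from hC.2)]; exact Finset.mem_insert_of_mem he')
      have hGn : ∀ C ∈ Rn, ∀ e' ∈ revealed no C,
          e' ∉ C → C ∈ U → insert e' C ∉ U → (C ∉ A ∧ insert e' C ∈ A) :=
        fun C hC e' he' => hG C hC.1 e' (by
          unfold revealed; rw [if_neg (show e ∉ C from hC.2)]; exact Finset.mem_insert_of_mem he')
      have IHy := tree_le D hp0 hp1 hU hA hUA yes (insert e S₀) Ry hRy_loc hGy
      have IHn := tree_le D hp0 hp1 hU hA hUA no (insert e S₀) Rn hRn_loc hGn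
      -- the one-step inequality at the root
      have hstep : Pr2W D p (Z ∩ hkWith (insert e S₀) U U) + Pr2W D p (Z ∩ hkWith S₀ A A) ≤
          Pr2W D p (Z ∩ hkWith (insert e S₀) A A) + Pr2W D p (Z ∩ hkWith S₀ U U) := by
        by_cases he : e ∈ S₀
        · rw [Finset.insert_eq_of_mem he, add_comm]
        · exact step_le D hp0 hp1 he hU hA hUA hR fun C hC => hG C hC e (he_rev C)
      -- unfold the node and split the one-step events by the query
      rw [Pr2W_treeHK_node, Pr2W_treeHK_node, hZy, hZn]
      rw [Pr2W_split D p Z (hkWith (insert e S₀) U U) e, Pr2W_split D p Z (hkWith (insert e S₀) A A) e,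
        hZy, hZn] at hstep
      linarith

/-- **Dominated increments ⟹ dominated variance** (comparison form of Gladkov's decision-tree Harris–Kleitman inequality).
For a down-set `U` and an up-set `A` with `U ∩ A = ∅`, and a decision tree `T` such that at every coordinate `e` queried on a
configuration `C` with `e ∉ C`: (`C ∈ U` and `C ∪ {e} ∉ U`) ⟹ (`C ∉ A` and `C ∪ {e} ∈ A`), one has
`P(C₁ ∈ U, C₁ →_{S(C₁)} C₂ ∈ U) − P(U)² ≤ P(C₁ ∈ A, C₁ →_{S(C₁)} C₂ ∈ A) − P(A)²`
(both sides are variances of the conditional probability given the leaf reached: Doob's decomposition).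
[cite: Gladkov2024, Thm. 3.2 and its proof (pattern); the comparison form is derived here] -/
theorem Pr2W_treeHK_sub_sq_le (D : Finset ι) {p : ι → ℝ} (hp0 : ∀ i, 0 ≤ p i) (hp1 : ∀ i, p i ≤ 1)
    {U A : Set (Finset ι)} (hU : IsLowerSet U) (hA : IsUpperSet A) (hUA : ∀ C ∈ U, C ∉ A) (T : DTree ι)
    (hG : ∀ C : Finset ι, ∀ e ∈ revealed T C, e ∉ C → C ∈ U → insert e C ∉ U → (C ∉ A ∧ insert e C ∈ A)) :
    Pr2W D p (treeHK ∅ T U U) - PrW D p U ^ 2 ≤ Pr2W D p (treeHK ∅ T A A) - PrW D p A ^ 2 := by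
  have h := tree_le D hp0 hp1 hU hA hUA T ∅ Set.univ (fun _ _ _ _ => Set.mem_univ _) fun C _ => hG C
  have huniv : ∀ Y : Set (Finset ι × Finset ι),
      {x : Finset ι × Finset ι | x.1 ∈ (Set.univ : Set (Finset ι))} ∩ Y = Y :=
    fun Y => by ext x; simp
  rw [huniv, huniv, huniv, huniv, hkWith_empty, hkWith_empty, Pr2W_prod, Pr2W_prod] at h
  rw [sq, sq]
  linarith

end TreeCompare

end Consts

end Summit.CriticalPhenomena.PercolationContinuityZ3.Theorems
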